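import Summits.CriticalPhenomena.PercolationContinuityZ3.Theorems.Transplant.SkelConcReachExcess
import Summits.CriticalPhenomena.PercolationContinuityZ3.Theorems.Transplant.SkelConcReachDeep
import Summits.CriticalPhenomena.PercolationContinuityZ3.Theorems.Transplant.SkelConcRealised
import Summits.CriticalPhenomena.PercolationContinuityZ3.Theorems.Transplant.SkelConcSchedule
import Summits.CriticalPhenomena.PercolationContinuityZ3.Theorems.Transplant.SkelConcAssemblyG
import HarnessLib

/-!
# Residue (C) at run histories for the concentric scheme of record over a planar skeleton

builds on p205010 (kernel theorem, internal audit signed; external expert review pending).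

Generic ((C), general node) twin of `BoxProdZ2.reachOblR_concGB` (`BoxProdZ2ConcReachRun`), Ω-route (lane ruling 2026-08-20):
**`Skel.reachOblRH_concSG`** — the run-restricted corridor obligations `Skel.ReachOblRH` of the scheme
`⟨Skel.cellGeomSG Φ C t (Skel.concRadiiS C gap gap' E₀ L'), q, δc⟩` from
* the habitat chain of `Skel.reachOblAtH_concSG` (p2-g4, `SkelConcReachHab`) over the fresh habitat `Skel.habΩ`, with the rim of
  step `i` := the part of the region beyond depth `E − L'`;
* the schedule's radii at realised triples (`Skel.reach_radii_concSG`), the column room `E₀ ≥ 44 r + 3` and `L' ≤ gap`;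
* the deep-entrance lemma `Skel.deep_of_run` and the rim excess `Skel.real_rim_le_concSG` (`SkelConcReachExcess`) fed by a
  uniform excess radius `Rex` synchronised with the schedule (`hsch`);
* as hypotheses: the per-step kit clauses at run histories (`hkitsR`, discharged by the kit layer) and the count.
[cite: KozmaNitzan2024, §4 Lemma 12 (pp. 23–25), p. 30 (Step IV), p. 31]
-/

open MeasureTheory

namespace Summit.CriticalPhenomena.PercolationContinuityZ3.Theorems

namespace Transplant

namespace Skel

open Literature.Probability.Percolation Literature.Probability.LatticeModels SimpleGraph GadgetSystem ProbeHistory HSiteScheme Contour KNCells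
open KNLevels
open Literature.Probability.Percolation.GM
open Literature.Probability.Percolation.KozmaNitzan.Cells (sgOf stepVec_apply_fst stepVec_apply_oth)
open Literature.Barriers.CriticalPhenomena (graphBall graphBall_finite mem_graphBall_self graphBall_mono)
open BoxProdZ2 (ConcRadiiG nQ nS Erad Frad Erad_mono Frad_succ Frad_le_Erad Erad_add_gap_le_Frad_succ)

open scoped Classical

variable {V : Type} [DecidableEq V] {G : SimpleGraph V} [G.LocallyFinite] (Φ : PlanarSkeletonConc G)

/-- The recursion dominates a linear drift: `E₀ + 20 r k ≤ E(k)` when every gap is `≥ 20 r`. [folklore] -/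
theorem E₀_add_mul_le_Erad {C : PCells} {gap : ℕ → ℕ} (gap' : ℕ → ℕ) (E₀ : ℕ) (hgap : ∀ n, 20 * C.r ≤ gap n) (k : ℕ) :
    E₀ + 20 * C.r * k ≤ Erad gap gap' E₀ k := by
  induction k with
  | zero => simp
  | succ k ih =>
    have h1 : Erad gap gap' E₀ k + gap (Erad gap gap' E₀ k) ≤ Erad gap gap' E₀ (k + 1) :=
      (Erad_add_gap_le_Frad_succ gap gap' E₀ k).trans (Frad_le_Erad gap gap' E₀ _)
    have h2 := hgap (Erad gap gap' E₀ k)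
    nlinarith

section Run

variable (C : PCells) (t : V) (gap gap' : ℕ → ℕ) (E₀ L' : ℕ) (q : unitInterval) (δc : ℝ)

/-- **RESIDUE (C) AT RUN HISTORIES, generic node (habitat form).** For the concentric scheme of record over a planar skeleton `Φ`
rooted at `t` (planar unit `tp = r/4`, neighbourhood radius `R'`, level depth `Rlev`, contact demand `N`, level window `[j₀, j₁]`),
the run-restricted corridor obligations `Skel.ReachOblRH` hold, given the schedule rooms (`20 r ≤ gap`, `L' ≤ gap`, `44 r + 3 ≤ E₀`),
a uniform excess radius `Rex` synchronised with the schedule (`hRex`, `hsch`), the count, and the per-step kit clauses at run histories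
(the `let`-bound premise, in the shape consumed by `Skel.reachOblAtH_concSG`, for every habitat chain record with the run's field values;
`S` abbreviates the scheme `SkelConc.concSchemeSG Φ C t (concRadiiS C gap gap' E₀ L') q δc`).
[cite: KozmaNitzan2024, §4 Lemma 12 (pp. 23–25), p. 30 (Step IV), p. 31] -/
theorem reachOblRH_concSG [Countable V] {tp R' Rlev N j₀ j₁ : ℕ} (hr : C.r = 4 * tp) (hR : 100 * R' ≤ tp) (hRl : Rlev + 1 ≤ R')
    (hj : j₁ ≤ Rlev) (hΛ : WFS C (concRadiiS C gap gap' E₀ L')) (hφ : Φ.φ t = 0) (hgap : ∀ n, 20 * C.r ≤ gap n) (hE₀ : 44 * C.r + 3 ≤ E₀)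
    (hgapL : ∀ ρ, L' ≤ gap ρ)
    {Δ' : ℕ} {δ η : ℝ} (hcount : 1 / (1 - (q : ℝ)) ^ (Δ' * N) ≤ δ * ((Finset.Icc j₀ j₁).card : ℝ)) (hη : η ≤ δ / 2)
    {Rex : ℕ → ℕ}
    (hRex : ∀ R₀' R₁, Rex R₀' ≤ R₁ → ∀ (Rw : ℕ) (D' A' : Finset V), (∀ d ∈ D', d ∈ graphBall G t Rw) →
      (∀ d ∈ D', ∀ d' ∈ D', Φ.φ d - Φ.φ d' ∈ box 2 (50 * C.r)) → A' ⊆ D' → (∀ a ∈ A', a ∈ graphBall G t R₀') →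
        (bondPercolation G q).real (excess G t R₁ D' A') ≤ η)
    (hsch : ∀ g, Rex (Erad gap gap' E₀ g + 1) + L' ≤ Erad gap gap' E₀ (g + 1)) :
    let S : KSchA V ℕ := SkelConc.concSchemeSG Φ C t (concRadiiS C gap gap' E₀ L') q δc
    (∀ (ω : BondConfig V) (n : ℕ) (e : Site 2 × MDir),
      (S.astOf₂ G (S.hst₂ G ω n)).st.choice = some e → S.Valid₂ G (S.hst₂ G ω n) e → ∀ du ∈ S.onward G (S.hst₂ G ω n) (tgt e),
      ∀ P : HabChainData V,
      P.Ω = habΩ Φ C t (Λ := concRadiiS C gap gap' E₀ L') q δc (S.hst₂ G ω n) e (S.aOf₂ G (S.hst₂ G ω n) e) du → P.C = C →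
      P.x = tgt e → P.du = du → P.root = t → P.Sfin = S.Sx G (S.hst₂ G ω n) e (S.aOf₁ G (S.hst₂ G ω n) e) (S.aOf₂ G (S.hst₂ G ω n) e) du →
      P.t = tp → P.R' = R' → P.Rlev = Rlev → P.N = N → P.j₀ = j₀ → P.j₁ = j₁ →
      ∀ i ≤ ChainPlanar.Sched.nLast, ∀ j ∈ Finset.Icc P.j₀ P.j₁,
      ∃ (σ : KNLevels.SData V) (Sz : Finset V),
      KNLevels.SHyp (winLDataIn Φ P.Ω (P.lo i) (P.hi i) P.root P.Sfin) j σ ∧ σ.N ≤ P.N ∧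
      (1 - (q : ℝ) ^ σ.sB) ^ σ.k ≤ δ ∧ Sz ⊆ (winLDataIn Φ P.Ω (P.lo i) (P.hi i) P.root P.Sfin).X j ∧ Sz ⊆ P.stepD Φ i ∧
      (∀ x ∈ σ.K, ∀ e' ∈ σ.seed x, e' ∉ wireSet (↑Sz : Set V)) ∧ (∀ x ∈ σ.K, σ.face x ⊆ Sz) ∧
      (∀ x ∈ σ.K, 1 - 3 * δ ≤ (prodBernoulli (S.Wcor G (faceDataSG Φ C t (concRadiiS C gap gap' E₀ L')) (S.hst₂ G ω n) e
          (S.aOf₁ G (S.hst₂ G ω n) e) (S.aOf₂ G (S.hst₂ G ω n) e) du)).real {ω' | ∃ u ∈ σ.face x,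
        1 - δ < (prodBernoulli (pinW (S.Wcor G (faceDataSG Φ C t (concRadiiS C gap gap' E₀ L')) (S.hst₂ G ω n) e
          (S.aOf₁ G (S.hst₂ G ω n) e) (S.aOf₂ G (S.hst₂ G ω n) e) du) (wireSet (↑Sz : Set V)) ω')).real
          (⋃ t' ∈ P.tgtE Φ i, openConnIn (↑(P.stepD Φ i) : Set V) u t')})) →
    ReachOblRH G S (faceDataSG Φ C t (concRadiiS C gap gap' E₀ L')) Δ' δ := by
  intro S hkitsR h e hrun hc hV du hdu
  obtain ⟨ω, n, rfl⟩ := hrun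
  have hE₀1 : 1 ≤ E₀ := by omega
  -- the schedule's radii at the realised triple (`α = aOf₁`, `β = aOf₂`, `E = E(nQ α y)`)
  obtain ⟨hEQ0, hBE0, hρ0, -, hM0, hgen0⟩ := reach_radii_concSG hgap hE₀1 hφ hc hV hdu
  -- (restated through the `abbrev SkelConc.concSchemeSG`, so that the arithmetic below sees one atom per radius)
  have hEQ : (concRadiiS C gap gap' E₀ L').rQ (S.aOf₁ G (S.hst₂ G ω n) e) (tgt e) =
      Erad gap gap' E₀ (nQ (S.aOf₁ G (S.hst₂ G ω n) e) (tgt e)) := hEQ0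
  have hBE : (concRadiiS C gap gap' E₀ L').rB (S.aOf₁ G (S.hst₂ G ω n) e) e.1 e.2 =
      Erad gap gap' E₀ (nQ (S.aOf₁ G (S.hst₂ G ω n) e) (tgt e)) := hBE0
  have hρ : ∀ ℓ, (concRadiiS C gap gap' E₀ L').ρ (S.aOf₂ G (S.hst₂ G ω n) e) (tgt e) du ℓ =
      Erad gap gap' E₀ (nQ (S.aOf₁ G (S.hst₂ G ω n) e) (tgt e)) - 2 := hρ0
  have hM : (concRadiiS C gap gap' E₀ L').rM (S.aOf₂ G (S.hst₂ G ω n) e) (tgt e + stepVec du) =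
      Frad gap gap' E₀ (nQ (S.aOf₁ G (S.hst₂ G ω n) e) (tgt e) + 1) - L' := hM0
  have hgen : nQ (S.aOf₁ G (S.hst₂ G ω n) e) (tgt e) = nS (S.aOf₁ G (S.hst₂ G ω n) e) e.1 + 1 := hgen0
  have hB : (concRadiiS C gap gap' E₀ L').rB (S.aOf₁ G (S.hst₂ G ω n) e) e.1 e.2 ≤
      Erad gap gap' E₀ (nQ (S.aOf₁ G (S.hst₂ G ω n) e) (tgt e)) := le_of_eq hBE
  have hρle : ∀ ℓ, (concRadiiS C gap gap' E₀ L').ρ (S.aOf₂ G (S.hst₂ G ω n) e) (tgt e) du ℓ ≤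
      Erad gap gap' E₀ (nQ (S.aOf₁ G (S.hst₂ G ω n) e) (tgt e)) := fun ℓ => by rw [hρ ℓ]; exact Nat.sub_le _ _
  -- the onward direction is not the way back (the source column is explored)
  have hdur : du ≠ rev e.2 := by
    rintro rfl
    obtain ⟨y, hy, hyc⟩ := hV.src_mem
    have h1 := (Finset.mem_filter.1 hdu).2 y hy
    rw [show tgt e + stepVec (rev e.2) = e.1 from tgt_tgt_rev e] at h1
    exact h1 hyc
  -- the column room: `20 r ‖y‖₁ + 44 r + 1 ≤ E - 2`
  have hl1 : (tgt e 0).natAbs + (tgt e 1).natAbs ≤ nQ (S.aOf₁ G (S.hst₂ G ω n) e) (tgt e) :=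
    l1_tgt_le_nQ (cellGeomSG_anchor Φ C t (concRadiiS C gap gap' E₀ L') q δc) (cellGeomSG_a₀ Φ C t (concRadiiS C gap gap' E₀ L') q δc) _ hc
  have hdrift : E₀ + 20 * C.r * nQ (S.aOf₁ G (S.hst₂ G ω n) e) (tgt e) ≤
      Erad gap gap' E₀ (nQ (S.aOf₁ G (S.hst₂ G ω n) e) (tgt e)) := E₀_add_mul_le_Erad gap' E₀ hgap _
  have hmul : 20 * C.r * ((tgt e 0).natAbs + (tgt e 1).natAbs) ≤ 20 * C.r * nQ (S.aOf₁ G (S.hst₂ G ω n) e) (tgt e) :=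
    Nat.mul_le_mul_left _ hl1
  have hcolQ : 20 * C.r * ((tgt e 0).natAbs + (tgt e 1).natAbs) + 44 * C.r + 1 ≤
      (concRadiiS C gap gap' E₀ L').rQ (S.aOf₁ G (S.hst₂ G ω n) e) (tgt e) := by
    rw [hEQ]; omega
  have hcolρ : ∀ ℓ, 20 * C.r * ((tgt e 0).natAbs + (tgt e 1).natAbs) + 44 * C.r + 1 ≤
      (concRadiiS C gap gap' E₀ L').ρ (S.aOf₂ G (S.hst₂ G ω n) e) (tgt e) du ℓ := fun ℓ => by
    rw [hρ ℓ]; omega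
  have hρM : ∀ ℓ, (concRadiiS C gap gap' E₀ L').ρ (S.aOf₂ G (S.hst₂ G ω n) e) (tgt e) du ℓ + 1 ≤
      (concRadiiS C gap gap' E₀ L').rM (S.aOf₂ G (S.hst₂ G ω n) e) (tgt e + stepVec du) := fun ℓ => by
    rw [hρ ℓ, hM, Frad_succ]
    have := hgapL (Erad gap gap' E₀ (nQ (S.aOf₁ G (S.hst₂ G ω n) e) (tgt e)))
    omega
  -- the excess radius fits below the rim depth
  have hRexE : Rex (Erad gap gap' E₀ (nS (S.aOf₁ G (S.hst₂ G ω n) e) e.1) + 1) ≤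
      Erad gap gap' E₀ (nQ (S.aOf₁ G (S.hst₂ G ω n) e) (tgt e)) - L' := by
    refine Nat.le_sub_of_add_le ?_
    rw [hgen]
    exact hsch _
  -- the choice at the run's macro-state, deep entrances along the run
  have hc' : ((S.scheme₂ G).stN n ω).choice = some e := by rw [S.stN_eq₂]; exact hc
  have hdeep := deep_of_run Φ C t gap gap' E₀ L' q δc hΛ hφ hgap hE₀1 ω n hc' hdu (S.aOf₂ G (S.hst₂ G ω n) e)
  -- the habitat chain record: fresh habitat, rims beyond depth `E - L'`
  let P : HabChainData V :=
    { Ω := habΩ Φ C t (Λ := concRadiiS C gap gap' E₀ L') q δc (S.hst₂ G ω n) e (S.aOf₂ G (S.hst₂ G ω n) e) du, C := C, x := tgt e, du := du,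
      t := tp, R' := R', Rlev := Rlev, N := N, j₀ := j₀, j₁ := j₁, root := t,
      Sfin := S.Sx G (S.hst₂ G ω n) e (S.aOf₁ G (S.hst₂ G ω n) e) (S.aOf₂ G (S.hst₂ G ω n) e) du,
      Rim := fun i => (Φ.WinIn (habΩ Φ C t (Λ := concRadiiS C gap gap' E₀ L') q δc (S.hst₂ G ω n) e (S.aOf₂ G (S.hst₂ G ω n) e) du)
          (ChainPlanar.Sched.region tp R' du.1 (sgOf du) (C.cen (tgt e)) i)).filter
        fun v => v ∉ graphBall G t (Erad gap gap' E₀ (nQ (S.aOf₁ G (S.hst₂ G ω n) e) (tgt e)) - L') }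
  have hRimD : ∀ i, P.Rim i ⊆ P.stepD Φ i := fun i => Finset.filter_subset _ _
  have hRimfar : ∀ i, ∀ v ∈ P.Rim i, v ∉ graphBall G t (Erad gap gap' E₀ (nQ (S.aOf₁ G (S.hst₂ G ω n) e) (tgt e)) - L') :=
    fun i v hv => (Finset.mem_filter.1 hv).2
  -- the regions lie in the habitat proper `Q_α(y) ∪ E^far_β`
  have hSt := stepsGeomSG Φ C t hΛ (Λ := concRadiiS C gap gap' E₀ L')
  have hDh : ∀ i ≤ ChainPlanar.Sched.nLast, P.stepD Φ i ⊆
      S.Γ.Q (S.aOf₁ G (S.hst₂ G ω n) e) (tgt e) ∪ S.Γ.Efar (S.aOf₂ G (S.hst₂ G ω n) e) (tgt e) du := by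
    intro i hi v hv
    have hvΩ := P.stepD_subset_Ω Φ i hv
    have hvφ : Φ.φ v ∈ C.Q (tgt e) ∪ C.Hfull (tgt e) du := ((Φ.mem_WinIn).1 (P.stepD_subset Φ hr hR hi hv)).2
    rcases mem_Q_or_Hfull_of_mem_habΩ Φ hdur hvΩ hvφ with hvQ | hvH
    · exact Finset.mem_union_left _ hvQ
    · exact hSt.Hfull_subset _ _ _ _ hV.anch hvH
  -- the rim excess
  have hexc : ∀ i ≤ ChainPlanar.Sched.nLast,
      (prodBernoulli (S.Wcor G (faceDataSG Φ C t (concRadiiS C gap gap' E₀ L')) (S.hst₂ G ω n) e (S.aOf₁ G (S.hst₂ G ω n) e)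
        (S.aOf₂ G (S.hst₂ G ω n) e) du)).real (⋃ t' ∈ P.Rim i, openConn t t') ≤ η := by
    intro i hi
    exact real_rim_le_concSG Φ hΛ hV hV.anch hdu hEQ hB hρle hdeep (hRex _) hRexE
      ((hRimD i).trans (P.stepD_subset_Ω Φ i)) ((hRimD i).trans (hDh i hi)) (hRimfar i)
  -- the kit clauses at this run
  have hkits := hkitsR ω n e hc hV du hdu P rfl rfl rfl rfl rfl rfl rfl rfl rfl rfl rfl rfl
  exact reachOblAtH_concSG Φ hΛ hφ hV hV.anch hdu hdur P rfl rfl rfl rfl rfl rfl hRimD hr hR hRl hj hcolQ hcolρ hρM hcount hkits hη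
    hexc


/-- **RESIDUE (C) AT RUN HISTORIES, generic node (habitat form) — PRIMED TWIN with a DISCHARGEABLE kit premise** (appended 2026-08-20,
p3-g5's statement snag): identical to `reachOblRH_concSG` except that the per-step kit clauses are asked only for habitat chain records whose rim
parts COVER the far level vertices — the extra hypothesis `∀ i, ∀ v ∈ P.stepD Φ i, v ∉ graphBall G t (E − L') → v ∈ P.Rim i` right after the
twelve field equations (the unprimed premise left `P.Rim` free, hence asked the clause also for `Rim := fun _ => ∅`, which no kit layer can supply;
the proof's own record `Rim i := (WinIn Ω (region i)).filter (· ∉ graphBall G t (E − L'))` satisfies the covering clause by `Finset.mem_filter`).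
This is the form the (C) plumbing (`Skel.HabChainData.hkits_cube`, p3-g5) discharges.
[cite: KozmaNitzan2024, §4 Lemma 12 (pp. 23–25), p. 30 (Step IV), p. 31] -/
theorem reachOblRH_concSG' [Countable V] {tp R' Rlev N j₀ j₁ : ℕ} (hr : C.r = 4 * tp) (hR : 100 * R' ≤ tp) (hRl : Rlev + 1 ≤ R')
    (hj : j₁ ≤ Rlev) (hΛ : WFS C (concRadiiS C gap gap' E₀ L')) (hφ : Φ.φ t = 0) (hgap : ∀ n, 20 * C.r ≤ gap n) (hE₀ : 44 * C.r + 3 ≤ E₀)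
    (hgapL : ∀ ρ, L' ≤ gap ρ)
    {Δ' : ℕ} {δ η : ℝ} (hcount : 1 / (1 - (q : ℝ)) ^ (Δ' * N) ≤ δ * ((Finset.Icc j₀ j₁).card : ℝ)) (hη : η ≤ δ / 2)
    {Rex : ℕ → ℕ}
    (hRex : ∀ R₀' R₁, Rex R₀' ≤ R₁ → ∀ (Rw : ℕ) (D' A' : Finset V), (∀ d ∈ D', d ∈ graphBall G t Rw) →
      (∀ d ∈ D', ∀ d' ∈ D', Φ.φ d - Φ.φ d' ∈ box 2 (50 * C.r)) → A' ⊆ D' → (∀ a ∈ A', a ∈ graphBall G t R₀') →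
        (bondPercolation G q).real (excess G t R₁ D' A') ≤ η)
    (hsch : ∀ g, Rex (Erad gap gap' E₀ g + 1) + L' ≤ Erad gap gap' E₀ (g + 1)) :
    let S : KSchA V ℕ := SkelConc.concSchemeSG Φ C t (concRadiiS C gap gap' E₀ L') q δc
    (∀ (ω : BondConfig V) (n : ℕ) (e : Site 2 × MDir),
      (S.astOf₂ G (S.hst₂ G ω n)).st.choice = some e → S.Valid₂ G (S.hst₂ G ω n) e → ∀ du ∈ S.onward G (S.hst₂ G ω n) (tgt e),
      ∀ P : HabChainData V,
      P.Ω = habΩ Φ C t (Λ := concRadiiS C gap gap' E₀ L') q δc (S.hst₂ G ω n) e (S.aOf₂ G (S.hst₂ G ω n) e) du → P.C = C →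
      P.x = tgt e → P.du = du → P.root = t → P.Sfin = S.Sx G (S.hst₂ G ω n) e (S.aOf₁ G (S.hst₂ G ω n) e) (S.aOf₂ G (S.hst₂ G ω n) e) du →
      P.t = tp → P.R' = R' → P.Rlev = Rlev → P.N = N → P.j₀ = j₀ → P.j₁ = j₁ →
      (∀ i, ∀ v ∈ P.stepD Φ i, v ∉ graphBall G t (Erad gap gap' E₀ (nQ (S.aOf₁ G (S.hst₂ G ω n) e) (tgt e)) - L') → v ∈ P.Rim i) →
      ∀ i ≤ ChainPlanar.Sched.nLast, ∀ j ∈ Finset.Icc P.j₀ P.j₁,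
      ∃ (σ : KNLevels.SData V) (Sz : Finset V),
      KNLevels.SHyp (winLDataIn Φ P.Ω (P.lo i) (P.hi i) P.root P.Sfin) j σ ∧ σ.N ≤ P.N ∧
      (1 - (q : ℝ) ^ σ.sB) ^ σ.k ≤ δ ∧ Sz ⊆ (winLDataIn Φ P.Ω (P.lo i) (P.hi i) P.root P.Sfin).X j ∧ Sz ⊆ P.stepD Φ i ∧
      (∀ x ∈ σ.K, ∀ e' ∈ σ.seed x, e' ∉ wireSet (↑Sz : Set V)) ∧ (∀ x ∈ σ.K, σ.face x ⊆ Sz) ∧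
      (∀ x ∈ σ.K, 1 - 3 * δ ≤ (prodBernoulli (S.Wcor G (faceDataSG Φ C t (concRadiiS C gap gap' E₀ L')) (S.hst₂ G ω n) e
          (S.aOf₁ G (S.hst₂ G ω n) e) (S.aOf₂ G (S.hst₂ G ω n) e) du)).real {ω' | ∃ u ∈ σ.face x,
        1 - δ < (prodBernoulli (pinW (S.Wcor G (faceDataSG Φ C t (concRadiiS C gap gap' E₀ L')) (S.hst₂ G ω n) e
          (S.aOf₁ G (S.hst₂ G ω n) e) (S.aOf₂ G (S.hst₂ G ω n) e) du) (wireSet (↑Sz : Set V)) ω')).real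
          (⋃ t' ∈ P.tgtE Φ i, openConnIn (↑(P.stepD Φ i) : Set V) u t')})) →
    ReachOblRH G S (faceDataSG Φ C t (concRadiiS C gap gap' E₀ L')) Δ' δ := by
  intro S hkitsR h e hrun hc hV du hdu
  obtain ⟨ω, n, rfl⟩ := hrun
  have hE₀1 : 1 ≤ E₀ := by omega
  -- the schedule's radii at the realised triple (`α = aOf₁`, `β = aOf₂`, `E = E(nQ α y)`)
  obtain ⟨hEQ0, hBE0, hρ0, -, hM0, hgen0⟩ := reach_radii_concSG hgap hE₀1 hφ hc hV hdu
  -- (restated through the `abbrev SkelConc.concSchemeSG`, so that the arithmetic below sees one atom per radius)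
  have hEQ : (concRadiiS C gap gap' E₀ L').rQ (S.aOf₁ G (S.hst₂ G ω n) e) (tgt e) =
      Erad gap gap' E₀ (nQ (S.aOf₁ G (S.hst₂ G ω n) e) (tgt e)) := hEQ0
  have hBE : (concRadiiS C gap gap' E₀ L').rB (S.aOf₁ G (S.hst₂ G ω n) e) e.1 e.2 =
      Erad gap gap' E₀ (nQ (S.aOf₁ G (S.hst₂ G ω n) e) (tgt e)) := hBE0
  have hρ : ∀ ℓ, (concRadiiS C gap gap' E₀ L').ρ (S.aOf₂ G (S.hst₂ G ω n) e) (tgt e) du ℓ =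
      Erad gap gap' E₀ (nQ (S.aOf₁ G (S.hst₂ G ω n) e) (tgt e)) - 2 := hρ0
  have hM : (concRadiiS C gap gap' E₀ L').rM (S.aOf₂ G (S.hst₂ G ω n) e) (tgt e + stepVec du) =
      Frad gap gap' E₀ (nQ (S.aOf₁ G (S.hst₂ G ω n) e) (tgt e) + 1) - L' := hM0
  have hgen : nQ (S.aOf₁ G (S.hst₂ G ω n) e) (tgt e) = nS (S.aOf₁ G (S.hst₂ G ω n) e) e.1 + 1 := hgen0
  have hB : (concRadiiS C gap gap' E₀ L').rB (S.aOf₁ G (S.hst₂ G ω n) e) e.1 e.2 ≤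
      Erad gap gap' E₀ (nQ (S.aOf₁ G (S.hst₂ G ω n) e) (tgt e)) := le_of_eq hBE
  have hρle : ∀ ℓ, (concRadiiS C gap gap' E₀ L').ρ (S.aOf₂ G (S.hst₂ G ω n) e) (tgt e) du ℓ ≤
      Erad gap gap' E₀ (nQ (S.aOf₁ G (S.hst₂ G ω n) e) (tgt e)) := fun ℓ => by rw [hρ ℓ]; exact Nat.sub_le _ _
  -- the onward direction is not the way back (the source column is explored)
  have hdur : du ≠ rev e.2 := by
    rintro rfl
    obtain ⟨y, hy, hyc⟩ := hV.src_mem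
    have h1 := (Finset.mem_filter.1 hdu).2 y hy
    rw [show tgt e + stepVec (rev e.2) = e.1 from tgt_tgt_rev e] at h1
    exact h1 hyc
  -- the column room: `20 r ‖y‖₁ + 44 r + 1 ≤ E - 2`
  have hl1 : (tgt e 0).natAbs + (tgt e 1).natAbs ≤ nQ (S.aOf₁ G (S.hst₂ G ω n) e) (tgt e) :=
    l1_tgt_le_nQ (cellGeomSG_anchor Φ C t (concRadiiS C gap gap' E₀ L') q δc) (cellGeomSG_a₀ Φ C t (concRadiiS C gap gap' E₀ L') q δc) _ hc
  have hdrift : E₀ + 20 * C.r * nQ (S.aOf₁ G (S.hst₂ G ω n) e) (tgt e) ≤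
      Erad gap gap' E₀ (nQ (S.aOf₁ G (S.hst₂ G ω n) e) (tgt e)) := E₀_add_mul_le_Erad gap' E₀ hgap _
  have hmul : 20 * C.r * ((tgt e 0).natAbs + (tgt e 1).natAbs) ≤ 20 * C.r * nQ (S.aOf₁ G (S.hst₂ G ω n) e) (tgt e) :=
    Nat.mul_le_mul_left _ hl1
  have hcolQ : 20 * C.r * ((tgt e 0).natAbs + (tgt e 1).natAbs) + 44 * C.r + 1 ≤
      (concRadiiS C gap gap' E₀ L').rQ (S.aOf₁ G (S.hst₂ G ω n) e) (tgt e) := by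
    rw [hEQ]; omega
  have hcolρ : ∀ ℓ, 20 * C.r * ((tgt e 0).natAbs + (tgt e 1).natAbs) + 44 * C.r + 1 ≤
      (concRadiiS C gap gap' E₀ L').ρ (S.aOf₂ G (S.hst₂ G ω n) e) (tgt e) du ℓ := fun ℓ => by
    rw [hρ ℓ]; omega
  have hρM : ∀ ℓ, (concRadiiS C gap gap' E₀ L').ρ (S.aOf₂ G (S.hst₂ G ω n) e) (tgt e) du ℓ + 1 ≤
      (concRadiiS C gap gap' E₀ L').rM (S.aOf₂ G (S.hst₂ G ω n) e) (tgt e + stepVec du) := fun ℓ => by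
    rw [hρ ℓ, hM, Frad_succ]
    have := hgapL (Erad gap gap' E₀ (nQ (S.aOf₁ G (S.hst₂ G ω n) e) (tgt e)))
    omega
  -- the excess radius fits below the rim depth
  have hRexE : Rex (Erad gap gap' E₀ (nS (S.aOf₁ G (S.hst₂ G ω n) e) e.1) + 1) ≤
      Erad gap gap' E₀ (nQ (S.aOf₁ G (S.hst₂ G ω n) e) (tgt e)) - L' := by
    refine Nat.le_sub_of_add_le ?_
    rw [hgen]
    exact hsch _
  -- the choice at the run's macro-state, deep entrances along the run
  have hc' : ((S.scheme₂ G).stN n ω).choice = some e := by rw [S.stN_eq₂]; exact hc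
  have hdeep := deep_of_run Φ C t gap gap' E₀ L' q δc hΛ hφ hgap hE₀1 ω n hc' hdu (S.aOf₂ G (S.hst₂ G ω n) e)
  -- the habitat chain record: fresh habitat, rims beyond depth `E - L'`
  let P : HabChainData V :=
    { Ω := habΩ Φ C t (Λ := concRadiiS C gap gap' E₀ L') q δc (S.hst₂ G ω n) e (S.aOf₂ G (S.hst₂ G ω n) e) du, C := C, x := tgt e, du := du,
      t := tp, R' := R', Rlev := Rlev, N := N, j₀ := j₀, j₁ := j₁, root := t,
      Sfin := S.Sx G (S.hst₂ G ω n) e (S.aOf₁ G (S.hst₂ G ω n) e) (S.aOf₂ G (S.hst₂ G ω n) e) du,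
      Rim := fun i => (Φ.WinIn (habΩ Φ C t (Λ := concRadiiS C gap gap' E₀ L') q δc (S.hst₂ G ω n) e (S.aOf₂ G (S.hst₂ G ω n) e) du)
          (ChainPlanar.Sched.region tp R' du.1 (sgOf du) (C.cen (tgt e)) i)).filter
        fun v => v ∉ graphBall G t (Erad gap gap' E₀ (nQ (S.aOf₁ G (S.hst₂ G ω n) e) (tgt e)) - L') }
  have hRimD : ∀ i, P.Rim i ⊆ P.stepD Φ i := fun i => Finset.filter_subset _ _
  have hRimfar : ∀ i, ∀ v ∈ P.Rim i, v ∉ graphBall G t (Erad gap gap' E₀ (nQ (S.aOf₁ G (S.hst₂ G ω n) e) (tgt e)) - L') :=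
    fun i v hv => (Finset.mem_filter.1 hv).2
  -- the regions lie in the habitat proper `Q_α(y) ∪ E^far_β`
  have hSt := stepsGeomSG Φ C t hΛ (Λ := concRadiiS C gap gap' E₀ L')
  have hDh : ∀ i ≤ ChainPlanar.Sched.nLast, P.stepD Φ i ⊆
      S.Γ.Q (S.aOf₁ G (S.hst₂ G ω n) e) (tgt e) ∪ S.Γ.Efar (S.aOf₂ G (S.hst₂ G ω n) e) (tgt e) du := by
    intro i hi v hv
    have hvΩ := P.stepD_subset_Ω Φ i hv
    have hvφ : Φ.φ v ∈ C.Q (tgt e) ∪ C.Hfull (tgt e) du := ((Φ.mem_WinIn).1 (P.stepD_subset Φ hr hR hi hv)).2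
    rcases mem_Q_or_Hfull_of_mem_habΩ Φ hdur hvΩ hvφ with hvQ | hvH
    · exact Finset.mem_union_left _ hvQ
    · exact hSt.Hfull_subset _ _ _ _ hV.anch hvH
  -- the rim excess
  have hexc : ∀ i ≤ ChainPlanar.Sched.nLast,
      (prodBernoulli (S.Wcor G (faceDataSG Φ C t (concRadiiS C gap gap' E₀ L')) (S.hst₂ G ω n) e (S.aOf₁ G (S.hst₂ G ω n) e)
        (S.aOf₂ G (S.hst₂ G ω n) e) du)).real (⋃ t' ∈ P.Rim i, openConn t t') ≤ η := by
    intro i hi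
    exact real_rim_le_concSG Φ hΛ hV hV.anch hdu hEQ hB hρle hdeep (hRex _) hRexE
      ((hRimD i).trans (P.stepD_subset_Ω Φ i)) ((hRimD i).trans (hDh i hi)) (hRimfar i)
  -- the kit clauses at this run
  have hkits := hkitsR ω n e hc hV du hdu P rfl rfl rfl rfl rfl rfl rfl rfl rfl rfl rfl rfl
    (fun i v hv hfar => Finset.mem_filter.2 ⟨hv, hfar⟩)
  exact reachOblAtH_concSG Φ hΛ hφ hV hV.anch hdu hdur P rfl rfl rfl rfl rfl rfl hRimD hr hR hRl hj hcolQ hcolρ hρM hcount hkits hη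
    hexc

end Run

end Skel

end Transplant

end Summit.CriticalPhenomena.PercolationContinuityZ3.Theorems
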